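import Mathlib
import HarnessLib

/-!
# Alternating sums of cyclic products of binomial coefficients are divisible by `C(n₁+n_m, n₁)`
# (Guo–Jouhet–Zeng 2007, Theorem 4.1) and Calkin's theorem `C(2n,n) ∣ Σ_k (−1)^k C(2n,k)^a` — PROVED

Topic `Literature/Combinatorics/Enumerative`.  Everything in this file is PROVED (no named fact, no
`sorry`); only Mathlib is imported.

## Sources, as printed (read on the page)

* [Calkin1998] N. J. Calkin, *Factors of sums of powers of binomial coefficients*, Acta Arith. **86** (1998)
  17–26 (held text `paper:doi-10-4064-aa-86-1-17-26`, p. 17 = p0001): "**Theorem 1.** For all positive `n`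
  and `a`, `Σ_{k=0}^{2n} (−1)^k C(2n,k)^a` is divisible by `C(2n,n)`."  (Calkin's proof, §5, goes through
  the `q`-analogue, his Theorem 2; §4, Proposition 8, is the one-line special case "`p ∣ C(2n,n) ⇒
  p ∣ h_{2n,a}`" by Lucas' theorem and the vanishing of an odd-digit alternating sum.)
* [GuoJouhetZeng2007] V. J. W. Guo, F. Jouhet, J. Zeng, *Factors of alternating sums of products of binomial
  and `q`-binomial coefficients*, Acta Arith. **127** (2007) 17–31 = arXiv:math/0511635 (held text
  `paper:arxiv-math_0511635`; §1 = p0002, §2 = p0004, §4 = p0007).  §1: "we have `[n k] = 0` if `k > n` or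
  `k < 0`."  §4: "Letting `q = 1` in Theorem 1.2 we obtain a direct generalization of Calkin's result (1.1).
  **Theorem 4.1.** For `m ≥ 3` and all positive integers `n_1, …, n_m`, there holds
  `Σ_{k=−n_1}^{n_1} (−1)^k ∏_{i=1}^{m} C(n_i+n_{i+1}, n_i+k)
     = C(n_1+n_m, n_1) Σ_λ ∏_{i=1}^{m−2} C(λ_{i−1}, λ_i) C(n_{i+1}+n_{i+2}, n_{i+1}−λ_i)`,     (4.1)
  where `n_{m+1} = λ_0 = n_1` and the sum is over all sequences `λ = (λ_1, …, λ_{m−2})` of nonnegative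
  integers such that `λ_0 ≥ λ_1 ≥ ⋯ ≥ λ_{m−2}`.  **Remark.** For `m = 1` and `2`, it is easy to see that the
  left-hand side of (4.1) is equal to `0` and `C(n_1+n_2, n_1)`, respectively.  Calkin's result follows from
  (4.1) by setting `n_i = n` for all `i = 1, …, m`."  §2, **Lemma 2.1** (eq. (2.1)): "Let `m ≥ 3`. Then for
  all positive integers `n_1,…,n_m` and any integer `j`, …
  `S(n_1,…,n_m;j,q) = Σ_{l=0}^{n_1} q^{l²} [n_1 l] [n_2+n_3  n_2−l] S(l,n_3,…,n_m;j−1,q)`", with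
  `S(n_1,…,n_m;j,q) = (q)_{n_1}(q)_{n_m}/(q)_{n_1+n_m} · Σ_k (−1)^k q^{jk²+C(k,2)} C(n_1,…,n_m;k)`,
  `C(a_1,…,a_l;k) = ∏_{i=1}^{l} [a_i+a_{i+1}  a_i+k]` (`a_{l+1} = a_1`), proved from the `q`-Pfaff–Saalschütz
  identity with `n_3 → ∞` and the substitution `l = r + k`; "**First proof of Theorem 1.2.** …
  `S(n_1,n_2;1,q) = 1`.  Theorem 1.2 then follows by iterating `(m−2)` times formula (2.1)."

## What is formalised (everything PROVED)

We formalise the `q = 1` specialisation of this proof (at `q = 1` the parameter `j` disappears).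
* `zb n k` — the binomial coefficient `C(n,k)` for INTEGER `n, k` with the printed convention (`0` unless
  `0 ≤ k ≤ n`), valued in `ℚ`; `cycProd (n_1,…,n_m) k = ∏_{i=1}^{m} C(n_i+n_{i+1}, n_i+k)` (`n_{m+1} = n_1`;
  a list of naturals, the consecutive product `pathProd` closed up by `C(n_m+n_1, n_m+k)`);
  `altSum (n_1,…,n_m) = Σ_{k=−n_1}^{n_1} (−1)^k cycProd(…;k)` (the left side of (4.1)); `iterSum` — the
  `λ`-sum on the right of (4.1), written as the iterated sum `T(n_1,n_2,n_3,…,n_m) =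
  Σ_{λ_1 ≤ n_1} C(n_1,λ_1) C(n_2+n_3, n_2−λ_1) T(λ_1,n_3,…,n_m)`, `T(n_1,n_2) = 1` (a natural number).
* `saalschutz_pointwise`, `vandermonde_zb`, `saalschutz_sum` — the `q = 1` shadow of the
  Pfaff–Saalschütz step: `Σ_l C(n_1−k,l−k) C(n_2+n_3,n_2−l) C(l+n_3,l+k) = C(n_1+n_2,n_1+k) C(n_2+n_3,n_2+k)`
  (proved by multiplying with `C(n_1+n_2,n_2+k) = Σ_l C(n_1+k,n_1−l) C(n_2−k,l−k)` (Chu–Vandermonde) and a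
  pointwise factorial identity; degenerate ranges of `k` checked directly);
* `lemma21_pointwise`, **`lemma21`** — Lemma 2.1 / eq. (2.1) at `q = 1` (multiplied through by
  `C(n_1+n_m,n_1)`): `altSum(n_1,n_2,n_3,…) = Σ_l [C(n_1+n_m,n_1) C(n_1,l) C(n_2+n_3,n_2−l)/C(l+n_m,l)] ·
  altSum(l,n_3,…)`;
* `altSum_pair` — the case `m = 2` of the Remark: `Σ_k (−1)^k C(n_1+n_2,n_1+k) C(n_1+n_2,n_2+k) =
  C(n_1+n_2,n_1)` (coefficient of `x^{2n_1}` in `(1−x)^N (1+x)^N = (1−x²)^N`);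
* **`theorem41`** — THEOREM 4.1 for every list of naturals of length `m ≥ 2`:
  `altSum(n_1,…,n_m) = C(n_1+n_m, n_1) · iterSum(n_1,…,n_m)` (induction on `m` by `lemma21`, i.e. the
  source's first proof "iterating `(m−2)` times formula (2.1)"); zero entries `n_i = 0` are allowed (the
  source assumes `n_i ≥ 1`; nothing changes);
* **`calkin_symmetric`**, **`calkin`** — CALKIN'S THEOREM 1: for `a ≥ 2`,
  `Σ_{k=−n}^{n} (−1)^k C(2n,n+k)^a = C(2n,n) · iterSum(n,…,n)`, and for all `n` and `a ≥ 1`,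
  `C(2n,n) ∣ Σ_{k=0}^{2n} (−1)^k C(2n,k)^a` in `ℤ` (the shift `k ↦ k − n`; `a = 1` separately:
  the sum is `0`, or `1 = C(0,0)` for `n = 0`).

Not covered: the `q`-analogues (Theorems 1.2, 1.3, 1.5, 1.6, Corollaries 4.2–4.12 with `q`), the second
proof via Andrews' formula, Section 3; the case `m = 1` of the Remark (`Σ_k (−1)^k C(2n_1, n_1+k) = 0` for
`n_1 ≥ 1`, Mathlib `Int.alternating_sum_range_choose`).

Cell zeta5-irr (HONEST FRAMING: systematic search; no irrationality claim unless certified).  WHAT THIS IS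
NOT: these are the classical FULL-SUM divisibilities (every `(−1)^k`-weighted cyclic product sum is a
multiple of `C(n_1+n_m,n_1)`); nothing here is the cell's unpublished swap-orbit / digit-exchange partial-sum
congruence, and nothing concerns `ζ(5)`.  Nearest existing declarations (not restated): Mathlib's
`Nat.add_choose_eq` (Chu–Vandermonde), `Int.alternating_sum_range_choose`, `Polynomial.coeff_one_add_X_pow`;
the tree's `BinomialSumEvaluations` (Kauers–Paule Problem 5.14; different sums).
-/

namespace Literature.Combinatorics.Enumerative.AlternatingBinomialProductSums

noncomputable section

open Finset
open scoped Nat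

/-! ## Binomial coefficients with integer indices

The printed sums run over `k = -n₁, …, n₁` and involve `C(n_i + n_{i+1}, n_i + k)` with the usual
convention `C(n, k) = 0` unless `0 ≤ k ≤ n` ([GuoJouhetZeng2007, §1: "we have `[n k] = 0` if `k > n` or
`k < 0`"]).  We render this by a rational-valued binomial with integer arguments. -/

/-- `zb n k = C(n, k)` for integers `n, k`, equal to `0` unless `0 ≤ k ≤ n` (the convention of
[GuoJouhetZeng2007, §1]), as a rational number. [cite: GuoJouhetZeng2007, §1 (conventions)] -/
def zb (n k : ℤ) : ℚ := if 0 ≤ k ∧ k ≤ n then ((n.toNat).choose k.toNat : ℚ) else 0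

/-- `C(n, k) = 0` for `k < 0`. [cite: GuoJouhetZeng2007, §1 (conventions)] -/
theorem zb_of_neg {n k : ℤ} (h : k < 0) : zb n k = 0 := by
  unfold zb
  rw [if_neg]
  omega

/-- `C(n, k) = 0` for `k > n`. [cite: GuoJouhetZeng2007, §1 (conventions)] -/
theorem zb_of_lt {n k : ℤ} (h : n < k) : zb n k = 0 := by
  unfold zb
  rw [if_neg]
  omega

/-- On natural numbers `zb` is the ordinary binomial coefficient. [cite: GuoJouhetZeng2007, §1 (conventions)] -/
theorem zb_natCast (n m : ℕ) : zb n m = (n.choose m : ℚ) := by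
  unfold zb
  by_cases h : m ≤ n
  · rw [if_pos (by omega)]
    simp
  · rw [if_neg (by omega), Nat.choose_eq_zero_of_lt (by omega), Nat.cast_zero]

/-- Evaluation in "complementary" form: if `n = x + y` and `k = x` then `zb n k = C(x + y, x)`.
[cite: GuoJouhetZeng2007, §1 (conventions)] -/
theorem zb_eq (n k : ℤ) (x y : ℕ) (hn : n = x + y) (hk : k = x) :
    zb n k = ((x + y).choose x : ℚ) := by
  have : zb n k = zb ((x + y : ℕ) : ℤ) (x : ℕ) := by rw [hn, hk]; push_cast; rfl
  rw [this, zb_natCast]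

/-- `zb n k ≥ 0`. [cite: GuoJouhetZeng2007, §1 (conventions)] -/
theorem zb_nonneg (n k : ℤ) : 0 ≤ zb n k := by
  unfold zb
  split_ifs
  · positivity
  · exact le_rfl

/-- `zb n k ≠ 0` when `0 ≤ k ≤ n`. [cite: GuoJouhetZeng2007, §1 (conventions)] -/
theorem zb_ne_zero {n k : ℤ} (h0 : 0 ≤ k) (h1 : k ≤ n) : zb n k ≠ 0 := by
  unfold zb
  rw [if_pos ⟨h0, h1⟩, Nat.cast_ne_zero]
  exact (Nat.choose_pos (by omega)).ne'

/-! ## Four factorial identities (the `q = 1` shadows of the `q`-Pfaff–Saalschütz step of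
[GuoJouhetZeng2007, §2, proof of Lemma 2.1])

Each is an identity between products of binomial coefficients written in the complementary form
`C(x + y, x) = (x + y)! / (x! y!)`; after this rewriting both sides are the same monomial in factorials. -/

/-- Pointwise identity behind the Pfaff–Saalschütz step, case `k ≥ 0`; variables
`t = n₁ − l`, `s = n₂ − l`, `b = l − k`, `c = n₃ − k`. [cite: GuoJouhetZeng2007, §2 (proof of Lemma 2.1)] -/
theorem factorial_identity₁ (t s b c k : ℕ) :
    (((t + b + 2 * k) + (s + b)).choose (t + b + 2 * k) : ℚ) *
        (((s + b + 2 * k) + c).choose (s + b + 2 * k) : ℚ) *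
        ((t + (b + 2 * k)).choose t : ℚ) * ((b + s).choose b : ℚ) =
      (((s + b + 2 * k) + (t + b)).choose (s + b + 2 * k) : ℚ) * ((b + t).choose b : ℚ) *
        ((s + (b + c + 2 * k)).choose s : ℚ) * (((b + 2 * k) + c).choose (b + 2 * k) : ℚ) := by
  simp only [Nat.cast_add_choose]
  ring_nf
  field_simp

/-- Pointwise identity behind the Pfaff–Saalschütz step, case `k = -κ < 0`; variables
`t = n₁ − l`, `s = n₂ − l`, `a = l + k`, `c = n₃`. [cite: GuoJouhetZeng2007, §2 (proof of Lemma 2.1)] -/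
theorem factorial_identity₂ (t s a c κ : ℕ) :
    (((t + a) + (s + a + 2 * κ)).choose (t + a) : ℚ) * (((s + a) + (c + κ)).choose (s + a) : ℚ) *
        (((t + a)).choose t : ℚ) * (((a + 2 * κ) + s).choose (a + 2 * κ) : ℚ) =
      (((s + a) + (t + a + 2 * κ)).choose (s + a) : ℚ) * (((a + 2 * κ) + t).choose (a + 2 * κ) : ℚ) *
        ((s + (c + a + κ)).choose s : ℚ) * ((a + (c + κ)).choose a : ℚ) := by
  simp only [Nat.cast_add_choose]
  ring_nf
  field_simp

/-- Pointwise identity moving the normalisation `C(n₁+e,n₁) C(n₁,l)/C(l+e,l)` through the closing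
binomial, case `k ≥ 0`; variables `t = n₁ − l`, `b = l − k`, `e = n_m`.
[cite: GuoJouhetZeng2007, §2 (proof of Lemma 2.1, last substitution)] -/
theorem factorial_identity₃ (t b e k : ℕ) :
    (((t + b + k) + e).choose (t + b + k) : ℚ) * (((b + k) + t).choose (b + k) : ℚ) *
        (((e + k) + b).choose (e + k) : ℚ) =
      (((b + k) + e).choose (b + k) : ℚ) * (((e + k) + (t + b)).choose (e + k) : ℚ) *
        ((b + t).choose b : ℚ) := by
  simp only [Nat.cast_add_choose]
  ring_nf
  field_simp

/-- The same, case `k = -κ < 0`; variables `t = n₁ − l`, `e = n_m = d + κ`.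
[cite: GuoJouhetZeng2007, §2 (proof of Lemma 2.1, last substitution)] -/
theorem factorial_identity₄ (t l d κ : ℕ) :
    (((t + l) + (d + κ)).choose (t + l) : ℚ) * ((l + t).choose l : ℚ) *
        ((d + (l + κ)).choose d : ℚ) =
      ((l + (d + κ)).choose l : ℚ) * ((d + (t + l + κ)).choose d : ℚ) *
        (((l + κ) + t).choose (l + κ) : ℚ) := by
  simp only [Nat.cast_add_choose]
  ring_nf
  field_simp

/-! ## The two pointwise identities with integer indices (all cases) -/

/-- **The Pfaff–Saalschütz step, pointwise** (`q = 1` shadow of the substitution in the proof of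
[GuoJouhetZeng2007, Lemma 2.1]): for `−n₁ ≤ k ≤ n₁`, `−n₂ ≤ k` and `0 ≤ l ≤ n₁`,
`C(N,n₁+k) C(n₂+n₃,n₂+k) · C(n₁+k,n₁−l) C(n₂−k,l−k) = C(N,n₂+k) · C(n₁−k,l−k) C(n₂+n₃,n₂−l) C(l+n₃,l+k)`,
`N = n₁ + n₂`, with the convention `C(n,k) = 0` unless `0 ≤ k ≤ n`.
[cite: GuoJouhetZeng2007, §2 (proof of Lemma 2.1)] -/
theorem saalschutz_pointwise (n₁ n₂ n₃ l : ℕ) (k : ℤ) (hk₁ : -(n₁ : ℤ) ≤ k) (hk₂ : k ≤ n₁)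
    (hk₃ : -(n₂ : ℤ) ≤ k) (hl : l ≤ n₁) :
    zb (n₁ + n₂) (n₁ + k) * zb (n₂ + n₃) (n₂ + k) * zb (n₁ + k) (n₁ - l) * zb (n₂ - k) (l - k) =
      zb (n₁ + n₂) (n₂ + k) * zb (n₁ - k) (l - k) * zb (n₂ + n₃) (n₂ - l) * zb (l + n₃) (l + k) := by
  by_cases hA : (l : ℤ) < k
  · have h : ∀ n, zb n ((l : ℤ) - k) = 0 := fun n => zb_of_neg (by omega)
    simp [h]
  by_cases hB : k < -(l : ℤ)
  · rw [zb_of_lt (show ((n₁ : ℤ) + k) < n₁ - l by omega), zb_of_neg (show (l : ℤ) + k < 0 by omega)]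
    simp
  by_cases hC : n₂ < l
  · rw [zb_of_lt (show ((n₂ : ℤ) - k) < l - k by omega), zb_of_neg (show (n₂ : ℤ) - l < 0 by omega)]
    simp
  by_cases hD : (n₃ : ℤ) < k
  · rw [zb_of_lt (show ((n₂ : ℤ) + n₃) < n₂ + k by omega), zb_of_lt (show ((l : ℤ) + n₃) < l + k by omega)]
    simp
  rw [not_lt] at hA hB hC hD
  -- main case: `|k| ≤ l ≤ min n₁ n₂`, `k ≤ n₃`
  rcases le_or_gt 0 k with hk0 | hk0
  · -- `k ≥ 0`
    obtain ⟨kk, rfl⟩ : ∃ kk : ℕ, k = kk := ⟨k.toNat, by omega⟩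
    obtain ⟨b, rfl⟩ : ∃ b : ℕ, l = b + kk := ⟨l - kk, by omega⟩
    obtain ⟨t, rfl⟩ : ∃ t : ℕ, n₁ = t + (b + kk) := ⟨n₁ - (b + kk), by omega⟩
    obtain ⟨s, rfl⟩ : ∃ s : ℕ, n₂ = s + (b + kk) := ⟨n₂ - (b + kk), by omega⟩
    obtain ⟨c, rfl⟩ : ∃ c : ℕ, n₃ = c + kk := ⟨n₃ - kk, by omega⟩
    rw [zb_eq (((t + (b + kk) : ℕ) : ℤ) + ((s + (b + kk) : ℕ) : ℤ)) (((t + (b + kk) : ℕ) : ℤ) + ((kk : ℕ) : ℤ)) (t + b + 2 * kk) (s + b) (by push_cast; ring) (by push_cast; ring),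
      zb_eq (((s + (b + kk) : ℕ) : ℤ) + ((c + kk : ℕ) : ℤ)) (((s + (b + kk) : ℕ) : ℤ) + ((kk : ℕ) : ℤ)) (s + b + 2 * kk) (c) (by push_cast; ring) (by push_cast; ring),
      zb_eq (((t + (b + kk) : ℕ) : ℤ) + ((kk : ℕ) : ℤ)) (((t + (b + kk) : ℕ) : ℤ) - ((b + kk : ℕ) : ℤ)) (t) (b + 2 * kk) (by push_cast; ring) (by push_cast; ring),
      zb_eq (((s + (b + kk) : ℕ) : ℤ) - ((kk : ℕ) : ℤ)) (((b + kk : ℕ) : ℤ) - ((kk : ℕ) : ℤ)) (b) (s) (by push_cast; ring) (by push_cast; ring),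
      zb_eq (((t + (b + kk) : ℕ) : ℤ) + ((s + (b + kk) : ℕ) : ℤ)) (((s + (b + kk) : ℕ) : ℤ) + ((kk : ℕ) : ℤ)) (s + b + 2 * kk) (t + b) (by push_cast; ring) (by push_cast; ring),
      zb_eq (((t + (b + kk) : ℕ) : ℤ) - ((kk : ℕ) : ℤ)) (((b + kk : ℕ) : ℤ) - ((kk : ℕ) : ℤ)) (b) (t) (by push_cast; ring) (by push_cast; ring),
      zb_eq (((s + (b + kk) : ℕ) : ℤ) + ((c + kk : ℕ) : ℤ)) (((s + (b + kk) : ℕ) : ℤ) - ((b + kk : ℕ) : ℤ)) (s) (b + c + 2 * kk) (by push_cast; ring) (by push_cast; ring),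
      zb_eq (((b + kk : ℕ) : ℤ) + ((c + kk : ℕ) : ℤ)) (((b + kk : ℕ) : ℤ) + ((kk : ℕ) : ℤ)) (b + 2 * kk) (c) (by push_cast; ring) (by push_cast; ring)]
    exact factorial_identity₁ t s b c kk
  · -- `k < 0`, `k = -κ`
    obtain ⟨κ, rfl⟩ : ∃ κ : ℕ, k = -(κ : ℤ) := ⟨(-k).toNat, by omega⟩
    obtain ⟨a, rfl⟩ : ∃ a : ℕ, l = a + κ := ⟨l - κ, by omega⟩
    obtain ⟨t, rfl⟩ : ∃ t : ℕ, n₁ = t + (a + κ) := ⟨n₁ - (a + κ), by omega⟩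
    obtain ⟨s, rfl⟩ : ∃ s : ℕ, n₂ = s + (a + κ) := ⟨n₂ - (a + κ), by omega⟩
    rw [zb_eq (((t + (a + κ) : ℕ) : ℤ) + ((s + (a + κ) : ℕ) : ℤ)) (((t + (a + κ) : ℕ) : ℤ) + -((κ : ℕ) : ℤ)) (t + a) (s + a + 2 * κ) (by push_cast; ring) (by push_cast; ring),
      zb_eq (((s + (a + κ) : ℕ) : ℤ) + ((n₃ : ℕ) : ℤ)) (((s + (a + κ) : ℕ) : ℤ) + -((κ : ℕ) : ℤ)) (s + a) (n₃ + κ) (by push_cast; ring) (by push_cast; ring),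
      zb_eq (((t + (a + κ) : ℕ) : ℤ) + -((κ : ℕ) : ℤ)) (((t + (a + κ) : ℕ) : ℤ) - ((a + κ : ℕ) : ℤ)) (t) (a) (by push_cast; ring) (by push_cast; ring),
      zb_eq (((s + (a + κ) : ℕ) : ℤ) - -((κ : ℕ) : ℤ)) (((a + κ : ℕ) : ℤ) - -((κ : ℕ) : ℤ)) (a + 2 * κ) (s) (by push_cast; ring) (by push_cast; ring),
      zb_eq (((t + (a + κ) : ℕ) : ℤ) + ((s + (a + κ) : ℕ) : ℤ)) (((s + (a + κ) : ℕ) : ℤ) + -((κ : ℕ) : ℤ)) (s + a) (t + a + 2 * κ) (by push_cast; ring) (by push_cast; ring),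
      zb_eq (((t + (a + κ) : ℕ) : ℤ) - -((κ : ℕ) : ℤ)) (((a + κ : ℕ) : ℤ) - -((κ : ℕ) : ℤ)) (a + 2 * κ) (t) (by push_cast; ring) (by push_cast; ring),
      zb_eq (((s + (a + κ) : ℕ) : ℤ) + ((n₃ : ℕ) : ℤ)) (((s + (a + κ) : ℕ) : ℤ) - ((a + κ : ℕ) : ℤ)) (s) (n₃ + a + κ) (by push_cast; ring) (by push_cast; ring),
      zb_eq (((a + κ : ℕ) : ℤ) + ((n₃ : ℕ) : ℤ)) (((a + κ : ℕ) : ℤ) + -((κ : ℕ) : ℤ)) (a) (n₃ + κ) (by push_cast; ring) (by push_cast; ring)]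
    exact factorial_identity₂ t s a n₃ κ

/-- **The normalisation step, pointwise**: for `0 ≤ l ≤ n₁` and `−n₁ ≤ k ≤ n₁`,
`C(n₁+e,n₁) C(n₁,l) · C(e+l,e+k) = C(l+e,l) · C(e+n₁,e+k) C(n₁−k,l−k)` (convention as above) — the
identity `(q)_{n_m+n_3} / ((q)_{n_3+l}(q)_{n_m+l}) …` substitution closing the proof of
[GuoJouhetZeng2007, Lemma 2.1], at `q = 1`. [cite: GuoJouhetZeng2007, §2 (proof of Lemma 2.1, last substitution)] -/
theorem normalisation_pointwise (n₁ e l : ℕ) (k : ℤ) (hk₁ : -(n₁ : ℤ) ≤ k) (hk₂ : k ≤ n₁) (hl : l ≤ n₁) :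
    ((n₁ + e).choose n₁ : ℚ) * (n₁.choose l : ℚ) * zb (e + l) (e + k) =
      ((l + e).choose l : ℚ) * zb (e + n₁) (e + k) * zb (n₁ - k) (l - k) := by
  by_cases hA : (e : ℤ) + k < 0
  · have h : ∀ n, zb n ((e : ℤ) + k) = 0 := fun n => zb_of_neg hA
    simp [h]
  by_cases hB : (l : ℤ) < k
  · rw [zb_of_lt (show ((e : ℤ) + l) < e + k by omega), zb_of_neg (show (l : ℤ) - k < 0 by omega)]
    simp
  rw [not_lt] at hA hB
  rcases le_or_gt 0 k with hk0 | hk0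
  · obtain ⟨kk, rfl⟩ : ∃ kk : ℕ, k = kk := ⟨k.toNat, by omega⟩
    obtain ⟨b, rfl⟩ : ∃ b : ℕ, l = b + kk := ⟨l - kk, by omega⟩
    obtain ⟨t, rfl⟩ : ∃ t : ℕ, n₁ = t + (b + kk) := ⟨n₁ - (b + kk), by omega⟩
    rw [zb_eq (((e : ℕ) : ℤ) + ((b + kk : ℕ) : ℤ)) (((e : ℕ) : ℤ) + ((kk : ℕ) : ℤ)) (e + kk) (b) (by push_cast; ring) (by push_cast; ring),
      zb_eq (((e : ℕ) : ℤ) + ((t + (b + kk) : ℕ) : ℤ)) (((e : ℕ) : ℤ) + ((kk : ℕ) : ℤ)) (e + kk) (t + b) (by push_cast; ring) (by push_cast; ring),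
      zb_eq (((t + (b + kk) : ℕ) : ℤ) - ((kk : ℕ) : ℤ)) (((b + kk : ℕ) : ℤ) - ((kk : ℕ) : ℤ)) (b) (t) (by push_cast; ring) (by push_cast; ring)]
    have h1 : ((t + (b + kk) + e).choose (t + (b + kk)) : ℚ) =
        (((t + b + kk) + e).choose (t + b + kk) : ℚ) := by rw [← add_assoc]
    have h2 : ((t + (b + kk)).choose (b + kk) : ℚ) = (((b + kk) + t).choose (b + kk) : ℚ) := by
      rw [add_comm t]
    rw [h1, h2]
    exact factorial_identity₃ t b e kk
  · obtain ⟨κ, rfl⟩ : ∃ κ : ℕ, k = -(κ : ℤ) := ⟨(-k).toNat, by omega⟩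
    obtain ⟨t, rfl⟩ : ∃ t : ℕ, n₁ = t + l := ⟨n₁ - l, by omega⟩
    obtain ⟨d, rfl⟩ : ∃ d : ℕ, e = d + κ := ⟨e - κ, by omega⟩
    rw [zb_eq (((d + κ : ℕ) : ℤ) + ((l : ℕ) : ℤ)) (((d + κ : ℕ) : ℤ) + -((κ : ℕ) : ℤ)) (d) (l + κ) (by push_cast; ring) (by push_cast; ring),
      zb_eq (((d + κ : ℕ) : ℤ) + ((t + l : ℕ) : ℤ)) (((d + κ : ℕ) : ℤ) + -((κ : ℕ) : ℤ)) (d) (t + l + κ) (by push_cast; ring) (by push_cast; ring),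
      zb_eq (((t + l : ℕ) : ℤ) - -((κ : ℕ) : ℤ)) (((l : ℕ) : ℤ) - -((κ : ℕ) : ℤ)) (l + κ) (t) (by push_cast; ring) (by push_cast; ring)]
    have h2 : ((t + l).choose l : ℚ) = ((l + t).choose l : ℚ) := by rw [add_comm t]
    rw [h2]
    exact factorial_identity₄ t l d κ

/-! ## The Chu–Vandermonde convolution and the `q = 1` Pfaff–Saalschütz sum -/

/-- **Chu–Vandermonde in the form used in [GuoJouhetZeng2007, §2]** ("letting `n₃ → ∞` in the
`q`-Pfaff–Saalschütz identity", at `q = 1`): for `|k| ≤ n₁`, `|k| ≤ n₂`,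
`Σ_{l=0}^{n₁} C(n₁+k, n₁−l) C(n₂−k, l−k) = C(n₁+n₂, n₂+k)` (substitution `l = r + k`).
[cite: GuoJouhetZeng2007, §2 (proof of Lemma 2.1, display after (2.3))] -/
theorem vandermonde_zb (n₁ n₂ : ℕ) (k : ℤ) (hk₁ : -(n₁ : ℤ) ≤ k) (hk₂ : k ≤ n₁) (hk₃ : -(n₂ : ℤ) ≤ k)
    (hk₄ : k ≤ n₂) :
    ∑ l ∈ range (n₁ + 1), zb (n₁ + k) (n₁ - l) * zb (n₂ - k) (l - k) = zb (n₁ + n₂) (n₂ + k) := by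
  -- natural parameters `p = n₁ + k`, `q = n₂ − k`, `K = n₁ − k`, `x = n₂ + k`
  obtain ⟨p, hp⟩ : ∃ p : ℕ, (p : ℤ) = n₁ + k := ⟨(n₁ + k).toNat, by omega⟩
  obtain ⟨q, hq⟩ : ∃ q : ℕ, (q : ℤ) = n₂ - k := ⟨(n₂ - k).toNat, by omega⟩
  obtain ⟨K, hK⟩ : ∃ K : ℕ, (K : ℤ) = n₁ - k := ⟨(n₁ - k).toNat, by omega⟩
  obtain ⟨x, hx⟩ : ∃ x : ℕ, (x : ℤ) = n₂ + k := ⟨(n₂ + k).toNat, by omega⟩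
  have hpq : p + q = x + K := by omega
  -- the summand as a function of `i = n₁ − l`
  set g : ℕ → ℚ := fun i => (p.choose i : ℚ) * zb q ((K : ℤ) - i) with hg
  have h1 : ∑ l ∈ range (n₁ + 1), zb (n₁ + k) (n₁ - l) * zb (n₂ - k) (l - k) =
      ∑ i ∈ range (n₁ + 1), g i := by
    rw [← Finset.sum_range_reflect g (n₁ + 1)]
    refine Finset.sum_congr rfl fun l hl => ?_
    have hl' : l ≤ n₁ := Nat.lt_succ_iff.mp (Finset.mem_range.mp hl)
    simp only [hg]
    rw [show n₁ + 1 - 1 - l = n₁ - l by omega, ← hp, ← hq,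
      show ((n₁ : ℤ) - l) = ((n₁ - l : ℕ) : ℤ) by push_cast [hl']; ring, zb_natCast]
    congr 2
    push_cast [hl']
    omega
  have hvan : ∀ i, n₁ + 1 ≤ i ∨ K + 1 ≤ i → g i = 0 := by
    intro i hi
    simp only [hg]
    rcases hi with hi | hi
    · by_cases hiK : K < i
      · rw [zb_of_neg (by omega), mul_zero]
      · rw [Nat.choose_eq_zero_of_lt (by omega), Nat.cast_zero, zero_mul]
    · rw [zb_of_neg (by omega), mul_zero]
  have h2 : ∑ i ∈ range (n₁ + 1), g i = ∑ i ∈ range (n₁ + K + 2), g i :=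
    Finset.sum_subset (Finset.range_subset_range.mpr (by omega)) fun i hi hi' =>
      hvan i (Or.inl (by simp only [Finset.mem_range] at hi hi'; omega))
  have h3 : ∑ i ∈ range (K + 1), g i = ∑ i ∈ range (n₁ + K + 2), g i :=
    Finset.sum_subset (Finset.range_subset_range.mpr (by omega)) fun i hi hi' =>
      hvan i (Or.inr (by simp only [Finset.mem_range] at hi hi'; omega))
  have h4 : ∑ i ∈ range (K + 1), g i = ((p + q).choose K : ℚ) := by
    rw [Nat.add_choose_eq, Finset.Nat.sum_antidiagonal_eq_sum_range_succ
      (fun i j => p.choose i * q.choose j) K, Nat.cast_sum]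
    refine Finset.sum_congr rfl fun i hi => ?_
    have hi' : i ≤ K := Nat.lt_succ_iff.mp (Finset.mem_range.mp hi)
    simp only [hg]
    rw [show ((K : ℤ) - i) = ((K - i : ℕ) : ℤ) by push_cast [hi']; ring, zb_natCast]
    push_cast
    ring
  rw [h1, h2, ← h3, h4, zb_eq _ _ x K (by omega) (by omega), hpq, Nat.choose_symm_add]

/-- **The `q = 1` Pfaff–Saalschütz sum** combining the two displays after (2.3) in the proof of
[GuoJouhetZeng2007, Lemma 2.1]: for `|k| ≤ n₁`,
`Σ_{l=0}^{n₁} C(n₁−k, l−k) C(n₂+n₃, n₂−l) C(l+n₃, l+k) = C(n₁+n₂, n₁+k) C(n₂+n₃, n₂+k)`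
(convention `C(n,k) = 0` unless `0 ≤ k ≤ n`).  Proof: multiply by `C(n₁+n₂, n₂+k)`, expand it by
`vandermonde_zb`, and compare termwise by `saalschutz_pointwise`; the degenerate ranges of `k` are
checked directly. [cite: GuoJouhetZeng2007, §2 (proof of Lemma 2.1)] -/
theorem saalschutz_sum (n₁ n₂ n₃ : ℕ) (k : ℤ) (hk₁ : -(n₁ : ℤ) ≤ k) (hk₂ : k ≤ n₁) :
    ∑ l ∈ range (n₁ + 1), zb (n₁ - k) (l - k) * zb (n₂ + n₃) (n₂ - l) * zb (l + n₃) (l + k) =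
      zb (n₁ + n₂) (n₁ + k) * zb (n₂ + n₃) (n₂ + k) := by
  by_cases ha : (n₂ : ℤ) < k
  · rw [zb_of_lt (show ((n₁ : ℤ) + n₂) < n₁ + k by omega), zero_mul]
    refine Finset.sum_eq_zero fun l hl => ?_
    by_cases hlk : (l : ℤ) < k
    · rw [zb_of_neg (show (l : ℤ) - k < 0 by omega)]; simp
    · rw [zb_of_neg (show (n₂ : ℤ) - l < 0 by omega)]; simp
  by_cases hb : k < -(n₂ : ℤ)
  · rw [zb_of_neg (show (n₂ : ℤ) + k < 0 by omega), mul_zero]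
    refine Finset.sum_eq_zero fun l hl => ?_
    by_cases hl2 : l ≤ n₂
    · rw [zb_of_neg (show (l : ℤ) + k < 0 by omega)]; simp
    · rw [zb_of_neg (show (n₂ : ℤ) - l < 0 by omega)]; simp
  by_cases hc : (n₃ : ℤ) < k
  · rw [zb_of_lt (show ((n₂ : ℤ) + n₃) < n₂ + k by omega), mul_zero]
    refine Finset.sum_eq_zero fun l hl => ?_
    rw [zb_of_lt (show ((l : ℤ) + n₃) < l + k by omega)]; simp
  rw [not_lt] at ha hb hc
  -- main case
  have hB : zb (n₁ + n₂) (n₂ + k) ≠ 0 := zb_ne_zero (by omega) (by omega)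
  have hV := vandermonde_zb n₁ n₂ k hk₁ hk₂ hb ha
  have key : ∀ l ∈ range (n₁ + 1),
      zb (n₁ + n₂) (n₂ + k) * (zb (n₁ - k) (l - k) * zb (n₂ + n₃) (n₂ - l) * zb (l + n₃) (l + k)) =
        zb (n₁ + n₂) (n₁ + k) * zb (n₂ + n₃) (n₂ + k) * (zb (n₁ + k) (n₁ - l) * zb (n₂ - k) (l - k)) := by
    intro l hl
    have hl' : l ≤ n₁ := Nat.lt_succ_iff.mp (Finset.mem_range.mp hl)
    have h := saalschutz_pointwise n₁ n₂ n₃ l k hk₁ hk₂ hb hl'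
    linear_combination -h
  apply mul_left_cancel₀ hB
  rw [Finset.mul_sum, Finset.sum_congr rfl key, ← Finset.mul_sum, hV]
  ring

/-! ## Lemma 2.1 of [GuoJouhetZeng2007] at `q = 1`, pointwise in `k` -/

/-- **The recurrence behind [GuoJouhetZeng2007, Lemma 2.1], at `q = 1` and pointwise in `k`.**
For `|k| ≤ n₁`, a middle weight `w` (the product of the binomials not involving `n₁, n₂`) and the
closing parameter `e = n_m`:
`C(N,n₁+k) C(n₂+n₃,n₂+k) · w · C(e+n₁,e+k)
  = Σ_{l=0}^{n₁} [C(n₁+e,n₁) C(n₁,l) C(n₂+n₃,n₂−l) / C(l+e,l)] · C(l+n₃,l+k) · w · C(e+l,e+k)`.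
Summed over `k` with the sign `(−1)^k` this is exactly (2.1) of the source,
`S(n₁,…,n_m;j,1) = Σ_l C(n₁,l) C(n₂+n₃,n₂−l) S(l,n₃,…,n_m;j−1,1)`.
[cite: GuoJouhetZeng2007, Lemma 2.1 (eq. (2.1)) and its proof, §2] -/
theorem lemma21_pointwise (n₁ n₂ n₃ e : ℕ) (k : ℤ) (w : ℚ) (hk₁ : -(n₁ : ℤ) ≤ k) (hk₂ : k ≤ n₁) :
    zb (n₁ + n₂) (n₁ + k) * zb (n₂ + n₃) (n₂ + k) * w * zb (e + n₁) (e + k) =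
      ∑ l ∈ range (n₁ + 1), ((n₁ + e).choose n₁ : ℚ) * (n₁.choose l : ℚ) * zb (n₂ + n₃) (n₂ - l) /
        ((l + e).choose l : ℚ) * (zb (l + n₃) (l + k) * w * zb (e + l) (e + k)) := by
  have hterm : ∀ l ∈ range (n₁ + 1),
      ((n₁ + e).choose n₁ : ℚ) * (n₁.choose l : ℚ) * zb (n₂ + n₃) (n₂ - l) / ((l + e).choose l : ℚ) *
          (zb (l + n₃) (l + k) * w * zb (e + l) (e + k)) =
        zb (e + n₁) (e + k) * w * (zb (n₁ - k) (l - k) * zb (n₂ + n₃) (n₂ - l) * zb (l + n₃) (l + k)) := by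
    intro l hl
    have hl' : l ≤ n₁ := Nat.lt_succ_iff.mp (Finset.mem_range.mp hl)
    have hC : ((l + e).choose l : ℚ) ≠ 0 := by
      rw [Nat.cast_ne_zero]; exact (Nat.choose_pos (by omega)).ne'
    have h4 := normalisation_pointwise n₁ e l k hk₁ hk₂ hl'
    rw [div_mul_eq_mul_div, div_eq_iff hC]
    linear_combination (zb (n₂ + n₃) (n₂ - l) * zb (l + n₃) (l + k) * w) * h4
  rw [Finset.sum_congr rfl hterm, ← Finset.mul_sum, saalschutz_sum n₁ n₂ n₃ k hk₁ hk₂]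
  ring

/-! ## Cyclic products of binomials along a list, the alternating sum, the iterated sum -/

/-- The last entry of a list of naturals (`0` for the empty list); for `(n₁,…,n_m)` this is `n_m`.
[cite: GuoJouhetZeng2007, Theorem 4.1 (the index `n_m`)] -/
def lastD : List ℕ → ℕ
  | [] => 0
  | [a] => a
  | _ :: b :: t => lastD (b :: t)

/-- `lastD (a :: b :: t) = lastD (b :: t)`. [cite: GuoJouhetZeng2007, Theorem 4.1 (the index `n_m`)] -/
theorem lastD_cons_cons (a b : ℕ) (t : List ℕ) : lastD (a :: b :: t) = lastD (b :: t) := rfl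

/-- The product over CONSECUTIVE pairs of the list: `∏_{i<m} C(n_i + n_{i+1}, n_i + k)`.
[cite: GuoJouhetZeng2007, §2 (the product `C(a_1,…,a_l;k)` without its closing factor)] -/
def pathProd : List ℕ → ℤ → ℚ
  | a :: b :: t, k => zb (a + b) (a + k) * pathProd (b :: t) k
  | _, _ => 1

/-- **The cyclic product** `C(n_1,…,n_m;k) = ∏_{i=1}^{m} C(n_i + n_{i+1}, n_i + k)` with `n_{m+1} = n_1`
(the product in [GuoJouhetZeng2007, Thm 4.1] and `C(a_1,…,a_l;k)` of its §2, at `q = 1`): the consecutive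
product closed up by the factor `C(n_m + n_1, n_m + k)`.
[cite: GuoJouhetZeng2007, §2 (definition of C(a_1,…,a_l;k)) and Theorem 4.1] -/
def cycProd (L : List ℕ) (k : ℤ) : ℚ := pathProd L k * zb (lastD L + L.headD 0) (lastD L + k)

/-- **The alternating sum** `Σ_{k=-n₁}^{n₁} (−1)^k ∏_{i=1}^m C(n_i+n_{i+1}, n_i+k)` — the left-hand side of
[GuoJouhetZeng2007, Theorem 4.1, eq. (4.1)]. [cite: GuoJouhetZeng2007, Theorem 4.1 (eq. (4.1), left side)] -/
def altSum (L : List ℕ) : ℚ :=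
  ∑ k ∈ Finset.Icc (-(L.headD 0 : ℤ)) (L.headD 0), (-1 : ℚ) ^ k * cycProd L k

/-- **The iterated sum** on the right of [GuoJouhetZeng2007, Theorem 4.1, eq. (4.1)]:
`Σ_λ ∏_{i=1}^{m−2} C(λ_{i−1}, λ_i) C(n_{i+1}+n_{i+2}, n_{i+1} − λ_i)` over `n₁ = λ₀ ≥ λ₁ ≥ ⋯ ≥ λ_{m−2} ≥ 0`,
written as the iterated sum `T(n₁,n₂,n₃,…,n_m) = Σ_{λ₁ ≤ n₁} C(n₁,λ₁) C(n₂+n₃, n₂−λ₁) T(λ₁,n₃,…,n_m)`,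
`T(n₁,n₂) = 1` (the empty product); the factor `C(λ_{i−1},λ_i)` enforces `λ_i ≤ λ_{i−1}` and `C(n,k) = 0`
for `k < 0`.  It is a natural number by construction.  (Value `1` also on lists of length `≤ 1`, not used.)
[cite: GuoJouhetZeng2007, Theorem 4.1 (eq. (4.1), right side)] -/
def iterSum : List ℕ → ℕ
  | n₁ :: n₂ :: n₃ :: t => ∑ l ∈ Finset.range (n₁ + 1),
      n₁.choose l * (if l ≤ n₂ then (n₂ + n₃).choose (n₂ - l) else 0) * iterSum (l :: n₃ :: t)
  | _ => 1
termination_by L => L.length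
decreasing_by simp

/-- `C(n₂+n₃, n₂−l)` with the convention `0` for `l > n₂`, as used in `iterSum`.
[cite: GuoJouhetZeng2007, §1 (conventions)] -/
theorem zb_sub_eq_ite (n₂ n₃ l : ℕ) :
    zb (n₂ + n₃) (n₂ - l) = ((if l ≤ n₂ then (n₂ + n₃).choose (n₂ - l) else 0 : ℕ) : ℚ) := by
  split_ifs with h
  · rw [show ((n₂ : ℤ) - l) = ((n₂ - l : ℕ) : ℤ) by omega,
      show ((n₂ : ℤ) + n₃) = ((n₂ + n₃ : ℕ) : ℤ) by omega, zb_natCast]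
  · rw [zb_of_neg (by omega), Nat.cast_zero]

/-- The summation range `[-n₁, n₁]` may be enlarged: the cyclic product vanishes for `|k| > n₁`
(`C(n₁+n₂, n₁+k) = 0` for `k < −n₁`, `C(n_m+n₁, n_m+k) = 0` for `k > n₁`).
[cite: GuoJouhetZeng2007, Theorem 4.1 (range of summation)] -/
theorem altSum_eq_sum_Icc (L : List ℕ) (K : ℕ) (hK : L.headD 0 ≤ K) :
    altSum L = ∑ k ∈ Finset.Icc (-(K : ℤ)) K, (-1 : ℚ) ^ k * cycProd L k := by
  unfold altSum
  refine Finset.sum_subset (Finset.Icc_subset_Icc (by omega) (by omega)) fun k hk hk' => ?_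
  simp only [Finset.mem_Icc, not_and_or, not_le] at hk hk'
  suffices h : cycProd L k = 0 by rw [h, mul_zero]
  unfold cycProd
  rcases hk' with hk' | hk'
  · -- `k < -head`: the first factor (or, for a singleton, the closing factor) vanishes
    rcases L with _ | ⟨a, _ | ⟨b, t⟩⟩
    · simp only [List.headD_nil, CharP.cast_eq_zero, neg_zero] at hk'
      rw [lastD, zb_of_neg (by simpa using hk'), mul_zero]
    · simp only [List.headD_cons] at hk'
      rw [lastD, zb_of_neg (by omega), mul_zero]
    · simp only [List.headD_cons] at hk'
      rw [pathProd, zb_of_neg (by omega), zero_mul, zero_mul]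
  · rw [zb_of_lt (by omega), mul_zero]

/-- Unfolding the cyclic product of a list with at least three entries:
`C(n₁,n₂,n₃,…,n_m;k) = C(n₁+n₂,n₁+k) C(n₂+n₃,n₂+k) · [middle product] · C(n_m+n₁,n_m+k)`.
[cite: GuoJouhetZeng2007, §2 (display "C(n_1,…,n_m;k) = … C(n_3,…,n_m;k)")] -/
theorem cycProd_cons_cons_cons (n₁ n₂ n₃ : ℕ) (t : List ℕ) (k : ℤ) :
    cycProd (n₁ :: n₂ :: n₃ :: t) k = zb (n₁ + n₂) (n₁ + k) * zb (n₂ + n₃) (n₂ + k) * pathProd (n₃ :: t) k *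
      zb (lastD (n₃ :: t) + n₁) (lastD (n₃ :: t) + k) := by
  unfold cycProd
  rw [lastD_cons_cons, lastD_cons_cons, List.headD_cons, pathProd, pathProd]
  ring

/-- Unfolding the cyclic product of a list with at least two entries:
`C(l,n₃,…,n_m;k) = C(l+n₃,l+k) · [middle product] · C(n_m+l,n_m+k)`.
[cite: GuoJouhetZeng2007, §2 (display "C(n_3,…,n_m;k) = … C(l,n_3,…,n_m;k)")] -/
theorem cycProd_cons_cons (l n₃ : ℕ) (t : List ℕ) (k : ℤ) :
    cycProd (l :: n₃ :: t) k = zb (l + n₃) (l + k) * pathProd (n₃ :: t) k *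
      zb (lastD (n₃ :: t) + l) (lastD (n₃ :: t) + k) := by
  unfold cycProd
  rw [lastD_cons_cons, List.headD_cons, pathProd]

/-! ## The case `m = 2`: `Σ_k (−1)^k C(n₁+n₂, n₁+k) C(n₁+n₂, n₂+k) = C(n₁+n₂, n₁)` -/

/-- Coefficients of `(1 − X)^N`: `[X^i] (1 − X)^N = (−1)^i C(N, i)`. [folklore] -/
private theorem coeff_one_sub_X_pow (N i : ℕ) :
    ((1 - Polynomial.X : Polynomial ℚ) ^ N).coeff i = (-1) ^ i * (N.choose i : ℚ) := by
  rw [sub_eq_add_neg, add_comm, add_pow, Polynomial.finsetSum_coeff]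
  have hterm : ∀ m ∈ range (N + 1),
      ((-Polynomial.X : Polynomial ℚ) ^ m * 1 ^ (N - m) * (N.choose m : Polynomial ℚ)).coeff i =
        if i = m then (-1) ^ i * (N.choose i : ℚ) else 0 := by
    intro m _
    rw [show (-Polynomial.X : Polynomial ℚ) ^ m * 1 ^ (N - m) * (N.choose m : Polynomial ℚ) =
        Polynomial.C ((-1 : ℚ) ^ m * N.choose m) * Polynomial.X ^ m by
          rw [map_mul, map_pow, map_neg, map_one, map_natCast]; ring,
      Polynomial.coeff_C_mul, Polynomial.coeff_X_pow]
    split_ifs with h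
    · subst h; ring
    · ring
  rw [Finset.sum_congr rfl hterm, Finset.sum_ite_eq]
  split_ifs with h
  · rfl
  · rw [Nat.choose_eq_zero_of_lt (by simpa using h), Nat.cast_zero, mul_zero]

/-- Coefficients of `(1 − X²)^N`: `[X^{2n}] (1 − X²)^N = (−1)^n C(N, n)`. [folklore] -/
private theorem coeff_one_sub_X_sq_pow (N n : ℕ) :
    ((1 - Polynomial.X ^ 2 : Polynomial ℚ) ^ N).coeff (2 * n) = (-1) ^ n * (N.choose n : ℚ) := by
  rw [sub_eq_add_neg, add_comm, add_pow, Polynomial.finsetSum_coeff]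
  have hterm : ∀ m ∈ range (N + 1),
      ((-(Polynomial.X ^ 2) : Polynomial ℚ) ^ m * 1 ^ (N - m) * (N.choose m : Polynomial ℚ)).coeff (2 * n) =
        if n = m then (-1) ^ n * (N.choose n : ℚ) else 0 := by
    intro m _
    rw [show (-(Polynomial.X ^ 2) : Polynomial ℚ) ^ m * 1 ^ (N - m) * (N.choose m : Polynomial ℚ) =
        Polynomial.C ((-1 : ℚ) ^ m * N.choose m) * Polynomial.X ^ (2 * m) by
          rw [map_mul, map_pow, map_neg, map_one, map_natCast]; ring,
      Polynomial.coeff_C_mul, Polynomial.coeff_X_pow]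
    by_cases h : n = m
    · subst h; simp
    · rw [if_neg (by omega), if_neg h, mul_zero]
  rw [Finset.sum_congr rfl hterm, Finset.sum_ite_eq]
  split_ifs with h
  · rfl
  · rw [Nat.choose_eq_zero_of_lt (by simpa using h), Nat.cast_zero, mul_zero]

/-- The classical alternating convolution `Σ_{i=0}^{2n} (−1)^i C(N,i) C(N,2n−i) = (−1)^n C(N,n)`
(`[X^{2n}]` of `(1−X)^N (1+X)^N = (1−X²)^N`). [folklore] -/
private theorem alternating_convolution (N n : ℕ) :
    ∑ i ∈ range (2 * n + 1), (-1 : ℚ) ^ i * (N.choose i : ℚ) * (N.choose (2 * n - i) : ℚ) =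
      (-1) ^ n * (N.choose n : ℚ) := by
  have hpoly : ((1 - Polynomial.X : Polynomial ℚ) ^ N) * (1 + Polynomial.X) ^ N =
      (1 - Polynomial.X ^ 2) ^ N := by
    rw [← mul_pow]; congr 1; ring
  have hcoef := congr_arg (fun p : Polynomial ℚ => p.coeff (2 * n)) hpoly
  rw [coeff_one_sub_X_sq_pow, Polynomial.coeff_mul,
    Finset.Nat.sum_antidiagonal_eq_sum_range_succ
      (fun i j => ((1 - Polynomial.X : Polynomial ℚ) ^ N).coeff i * ((1 + Polynomial.X) ^ N).coeff j)] at hcoef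
  rw [← hcoef]
  refine Finset.sum_congr rfl fun i _ => ?_
  rw [coeff_one_sub_X_pow, Polynomial.coeff_one_add_X_pow]

/-- `(−1)^{i−n} = (−1)^i (−1)^n` for the integer power. [folklore] -/
private theorem neg_one_zpow_sub (i n : ℕ) : (-1 : ℚ) ^ ((i : ℤ) - n) = (-1) ^ i * (-1) ^ n := by
  rw [zpow_sub₀ (by norm_num : (-1 : ℚ) ≠ 0), zpow_natCast, zpow_natCast, div_eq_mul_inv, ← inv_pow,
    inv_neg, inv_one]

/-- Re-indexing `k = i − n`: a sum over `k ∈ [−n, n]` is a sum over `i ∈ [0, 2n]`. [folklore] -/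
private theorem sum_Icc_neg_eq_sum_range (f : ℤ → ℚ) (n : ℕ) :
    ∑ k ∈ Finset.Icc (-(n : ℤ)) n, f k = ∑ i ∈ range (2 * n + 1), f ((i : ℤ) - n) := by
  refine Finset.sum_nbij' (fun k => (k + n).toNat) (fun i => (i : ℤ) - n) ?_ ?_ ?_ ?_ ?_
  · intro k hk
    simp only [Finset.mem_Icc] at hk ⊢
    simp only [Finset.mem_range]
    omega
  · intro i hi
    simp only [Finset.mem_range] at hi ⊢
    simp only [Finset.mem_Icc]
    omega
  · intro k hk
    simp only [Finset.mem_Icc] at hk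
    omega
  · intro i hi
    simp only [Finset.mem_range] at hi
    omega
  · intro k hk
    simp only [Finset.mem_Icc] at hk
    congr 1
    omega

/-- **The case `m = 2`** ([GuoJouhetZeng2007, Remark after Theorem 4.1]: "for `m = 2` … the left-hand side
of (4.1) is equal to `C(n₁+n₂, n₁)`"): `Σ_{k=−n₁}^{n₁} (−1)^k C(n₁+n₂, n₁+k) C(n₂+n₁, n₂+k) = C(n₁+n₂, n₁)`.
[cite: GuoJouhetZeng2007, Remark after Theorem 4.1 (case m = 2)] -/
theorem altSum_pair (n₁ n₂ : ℕ) : altSum [n₁, n₂] = ((n₁ + n₂).choose n₁ : ℚ) := by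
  unfold altSum cycProd
  simp only [List.headD_cons, pathProd, lastD, mul_one]
  rw [sum_Icc_neg_eq_sum_range]
  have hN : ∀ i ∈ range (2 * n₁ + 1),
      (-1 : ℚ) ^ ((i : ℤ) - n₁) * (zb (n₁ + n₂) (n₁ + ((i : ℤ) - n₁)) * zb (n₂ + n₁) (n₂ + ((i : ℤ) - n₁))) =
        (-1) ^ n₁ * ((-1 : ℚ) ^ i * ((n₁ + n₂).choose i : ℚ) * ((n₁ + n₂).choose (2 * n₁ - i) : ℚ)) := by
    intro i hi
    have hi' : i ≤ 2 * n₁ := Nat.lt_succ_iff.mp (Finset.mem_range.mp hi)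
    rw [neg_one_zpow_sub, show (n₁ : ℤ) + ((i : ℤ) - n₁) = (i : ℕ) by ring,
      show ((n₁ : ℤ) + n₂) = ((n₁ + n₂ : ℕ) : ℤ) by push_cast; ring, zb_natCast]
    by_cases h : n₁ ≤ n₂ + i
    · rw [zb_eq ((n₂ : ℤ) + n₁) ((n₂ : ℤ) + ((i : ℤ) - n₁)) (n₂ + i - n₁) (2 * n₁ - i)
        (by push_cast [h, hi']; ring) (by push_cast [h]; ring),
        show n₂ + i - n₁ + (2 * n₁ - i) = n₁ + n₂ by omega,
        show n₂ + i - n₁ = (n₁ + n₂) - (2 * n₁ - i) by omega, Nat.choose_symm (by omega)]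
      ring
    · rw [zb_of_neg (by omega), Nat.choose_eq_zero_of_lt (show n₁ + n₂ < 2 * n₁ - i by omega)]
      simp
  rw [Finset.sum_congr rfl hN, ← Finset.mul_sum, alternating_convolution, ← mul_assoc, ← pow_add,
    ← two_mul, pow_mul]
  norm_num

/-! ## Theorem 4.1 of [GuoJouhetZeng2007] (the `q = 1` case of their Theorem 1.2) -/

/-- **Lemma 2.1 of [GuoJouhetZeng2007] at `q = 1`** (the recurrence (2.1), multiplied through by
`C(n₁+n_m, n₁)`): for `m ≥ 3`,
`A(n₁,n₂,n₃,…,n_m) = Σ_{l=0}^{n₁} [C(n₁+n_m,n₁) C(n₁,l) C(n₂+n₃,n₂−l) / C(l+n_m,l)] · A(l,n₃,…,n_m)`,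
`A` the alternating sum of cyclic products. [cite: GuoJouhetZeng2007, Lemma 2.1 (eq. (2.1))] -/
theorem lemma21 (n₁ n₂ n₃ : ℕ) (t : List ℕ) :
    altSum (n₁ :: n₂ :: n₃ :: t) =
      ∑ l ∈ range (n₁ + 1), ((n₁ + lastD (n₃ :: t)).choose n₁ : ℚ) * (n₁.choose l : ℚ) *
        zb (n₂ + n₃) (n₂ - l) / ((l + lastD (n₃ :: t)).choose l : ℚ) * altSum (l :: n₃ :: t) := by
  have hstep : ∀ k ∈ Finset.Icc (-(n₁ : ℤ)) n₁, (-1 : ℚ) ^ k * cycProd (n₁ :: n₂ :: n₃ :: t) k =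
      ∑ l ∈ range (n₁ + 1), ((n₁ + lastD (n₃ :: t)).choose n₁ : ℚ) * (n₁.choose l : ℚ) *
        zb (n₂ + n₃) (n₂ - l) / ((l + lastD (n₃ :: t)).choose l : ℚ) *
          ((-1 : ℚ) ^ k * cycProd (l :: n₃ :: t) k) := by
    intro k hk
    simp only [Finset.mem_Icc] at hk
    have h := lemma21_pointwise n₁ n₂ n₃ (lastD (n₃ :: t)) k (pathProd (n₃ :: t) k) hk.1 hk.2
    rw [cycProd_cons_cons_cons, h, Finset.mul_sum]
    refine Finset.sum_congr rfl fun l _ => ?_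
    rw [cycProd_cons_cons]
    ring
  rw [altSum]
  simp only [List.headD_cons]
  rw [Finset.sum_congr rfl hstep, Finset.sum_comm]
  refine Finset.sum_congr rfl fun l hl => ?_
  have hl' : l ≤ n₁ := Nat.lt_succ_iff.mp (Finset.mem_range.mp hl)
  rw [← Finset.mul_sum, altSum_eq_sum_Icc (l :: n₃ :: t) n₁ (by simpa using hl')]

/-- **Theorem 4.1 of [GuoJouhetZeng2007]** (= Theorem 1.2, the multi-sum generalisation of Calkin's
theorem, at `q = 1`), for every list `(n₁,…,n_m)` of natural numbers with `m ≥ 2`: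
`Σ_{k=−n₁}^{n₁} (−1)^k ∏_{i=1}^m C(n_i+n_{i+1}, n_i+k) = C(n₁+n_m, n₁) · Σ_λ ∏_{i=1}^{m−2} C(λ_{i−1},λ_i)
C(n_{i+1}+n_{i+2}, n_{i+1}−λ_i)` (`n_{m+1} = λ₀ = n₁`, `λ` non-increasing; the `λ`-sum is `iterSum`,
equal to `1` for `m = 2`).  The source states it for `m ≥ 3` and positive `n_i`, and records the case
`m = 2` in the Remark that follows; zero entries are harmless.  Proof: induction on `m` by `lemma21`
(the source's first proof of Theorem 1.2, iterating (2.1), at `q = 1`), base `altSum_pair`.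
[cite: GuoJouhetZeng2007, Theorem 4.1 (and Remark; Theorem 1.2 at q = 1)] -/
theorem theorem41 : ∀ (L : List ℕ), 2 ≤ L.length →
    altSum L = ((L.headD 0 + lastD L).choose (L.headD 0) : ℚ) * iterSum L := by
  suffices h : ∀ (m : ℕ) (L : List ℕ), L.length = m → 2 ≤ m →
      altSum L = ((L.headD 0 + lastD L).choose (L.headD 0) : ℚ) * iterSum L from
    fun L hL => h L.length L rfl hL
  intro m
  induction m using Nat.strong_induction_on with
  | _ m ih =>
    intro L hL hm
    rcases L with _ | ⟨n₁, _ | ⟨n₂, _ | ⟨n₃, t⟩⟩⟩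
    · simp at hL; omega
    · simp at hL; omega
    · -- `m = 2`
      rw [altSum_pair]
      simp [lastD, iterSum]
    · -- `m ≥ 3`
      rw [lemma21, iterSum]
      simp only [List.headD_cons, lastD_cons_cons]
      push_cast
      rw [Finset.mul_sum]
      refine Finset.sum_congr rfl fun l hl => ?_
      have hlen : (l :: n₃ :: t).length < m := by rw [← hL]; simp
      rw [ih _ hlen (l :: n₃ :: t) rfl (by simp), zb_sub_eq_ite]
      simp only [List.headD_cons, lastD_cons_cons]
      have hC : ((l + lastD (n₃ :: t)).choose l : ℚ) ≠ 0 := by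
        rw [Nat.cast_ne_zero]; exact (Nat.choose_pos (by omega)).ne'
      field_simp
      push_cast
      ring

/-! ## Calkin's theorem -/

/-- The last entry of the constant list `(n,…,n)` is `n`.
[cite: GuoJouhetZeng2007, Remark after Theorem 4.1 ("setting n_i = n for all i")] -/
theorem lastD_replicate (a n : ℕ) : lastD (List.replicate (a + 1) n) = n := by
  induction a with
  | zero => simp [List.replicate, lastD]
  | succ a ih =>
    rw [show List.replicate (a + 1 + 1) n = n :: n :: List.replicate a n by simp [List.replicate],
      lastD_cons_cons, show n :: List.replicate a n = List.replicate (a + 1) n by simp [List.replicate], ih]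

/-- For the constant list the consecutive product is `C(2n, n+k)^a` (`a + 1` entries).
[cite: GuoJouhetZeng2007, Remark after Theorem 4.1 ("setting n_i = n for all i")] -/
theorem pathProd_replicate (a n : ℕ) (k : ℤ) :
    pathProd (List.replicate (a + 1) n) k = zb (n + n) (n + k) ^ a := by
  induction a with
  | zero => simp [List.replicate, pathProd]
  | succ a ih =>
    rw [show List.replicate (a + 1 + 1) n = n :: n :: List.replicate a n by simp [List.replicate],
      pathProd, show n :: List.replicate a n = List.replicate (a + 1) n by simp [List.replicate], ih]
    ring

/-- For the constant list `(n,…,n)` (`a + 1` entries) the cyclic product is `C(2n, n+k)^{a+1}`.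
[cite: GuoJouhetZeng2007, Remark after Theorem 4.1 ("setting n_i = n for all i")] -/
theorem cycProd_replicate (a n : ℕ) (k : ℤ) :
    cycProd (List.replicate (a + 1) n) k = zb (n + n) (n + k) ^ (a + 1) := by
  rw [cycProd, pathProd_replicate, lastD_replicate]
  simp [List.replicate, pow_succ]

/-- **Calkin's sum in symmetric form**: for `a ≥ 2`,
`Σ_{k=−n}^{n} (−1)^k C(2n, n+k)^a = C(2n, n) · T(n,…,n)` with the natural number `T = iterSum`.
[cite: Calkin1998, Theorem 1] [cite: GuoJouhetZeng2007, Remark after Theorem 4.1] -/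
theorem calkin_symmetric (a n : ℕ) (ha : 2 ≤ a) :
    ∑ k ∈ Finset.Icc (-(n : ℤ)) n, (-1 : ℚ) ^ k * zb (n + n) (n + k) ^ a =
      ((n + n).choose n : ℚ) * iterSum (List.replicate a n) := by
  obtain ⟨b, rfl⟩ : ∃ b, a = b + 1 := ⟨a - 1, by omega⟩
  have h := theorem41 (List.replicate (b + 1) n) (by simp; omega)
  rw [altSum, lastD_replicate] at h
  simp only [List.replicate_succ, List.headD_cons] at h
  simp only [← List.replicate_succ, cycProd_replicate] at h
  exact_mod_cast h

/-- **Calkin's theorem** [Calkin1998, Theorem 1]: "For all positive `n` and `a`,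
`Σ_{k=0}^{2n} (−1)^k C(2n, k)^a` is divisible by `C(2n, n)`."  (Here for all `n, a : ℕ` with `a ≥ 1`; for
`a = 1` the sum is `0`, resp. `1 = C(0,0)` when `n = 0`.)  Proof: for `a ≥ 2` this is the constant-list
case of `theorem41` ([GuoJouhetZeng2007, Remark after Thm 4.1]) after the shift `k ↦ k − n`.
[cite: Calkin1998, Theorem 1] [cite: GuoJouhetZeng2007, Theorem 4.1 and Remark] -/
theorem calkin (n a : ℕ) (ha : 1 ≤ a) :
    ((2 * n).choose n : ℤ) ∣ ∑ k ∈ range (2 * n + 1), (-1 : ℤ) ^ k * ((2 * n).choose k : ℤ) ^ a := by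
  rcases Nat.lt_or_ge a 2 with ha2 | ha2
  · -- `a = 1`
    obtain rfl : a = 1 := by omega
    simp only [pow_one]
    rw [Int.alternating_sum_range_choose]
    split_ifs with h
    · rw [show n = 0 by omega]; simp
    · exact dvd_zero _
  · refine ⟨(-1) ^ n * (iterSum (List.replicate a n) : ℤ), ?_⟩
    have h := calkin_symmetric a n ha2
    rw [sum_Icc_neg_eq_sum_range] at h
    simp only [← two_mul] at h
    have hq : (∑ k ∈ range (2 * n + 1), (-1 : ℚ) ^ k * ((2 * n).choose k : ℚ) ^ a) =
        ((2 * n).choose n : ℚ) * ((-1) ^ n * (iterSum (List.replicate a n) : ℚ)) := by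
      calc (∑ k ∈ range (2 * n + 1), (-1 : ℚ) ^ k * ((2 * n).choose k : ℚ) ^ a)
          = ∑ i ∈ range (2 * n + 1), (-1 : ℚ) ^ n *
              ((-1 : ℚ) ^ ((i : ℤ) - n) * zb (2 * (n : ℤ)) (n + ((i : ℤ) - n)) ^ a) := by
            refine Finset.sum_congr rfl fun i hi => ?_
            rw [neg_one_zpow_sub, show (n : ℤ) + ((i : ℤ) - n) = (i : ℕ) by ring,
              show (2 * (n : ℤ)) = ((2 * n : ℕ) : ℤ) by push_cast; ring, zb_natCast,
              show (-1 : ℚ) ^ n * ((-1) ^ i * (-1) ^ n * ((2 * n).choose i : ℚ) ^ a) =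
                (-1) ^ i * ((2 * n).choose i : ℚ) ^ a * ((-1) ^ n * (-1) ^ n) by ring,
              ← pow_add, ← two_mul, pow_mul]
            norm_num
        _ = (-1 : ℚ) ^ n * (((2 * n).choose n : ℚ) * (iterSum (List.replicate a n) : ℚ)) := by
            rw [← Finset.mul_sum, h]
        _ = _ := by ring
    exact_mod_cast hq

/-! ## Sanity instances -/

/-- `T(1,1,1) = C(1,0)C(2,1) + C(1,1)C(2,0) = 3`, matching `Σ_{k=−1}^{1} (−1)^k C(2,1+k)³ = −1+8−1 = 6 =
C(2,1)·3`. [cite: GuoJouhetZeng2007, Theorem 4.1 (instance m = 3, n = (1,1,1))] -/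
example : iterSum [1, 1, 1] = 3 := by
  simp [iterSum, Finset.sum_range_succ]

/-- Calkin's theorem at `n = 2`, `a = 3`: `C(4,2) = 6` divides `1 − 64 + 216 − 64 + 1 = 90`.
[cite: Calkin1998, Theorem 1 (instance n = 2, a = 3)] -/
example : ((2 * 2).choose 2 : ℤ) ∣ ∑ k ∈ range (2 * 2 + 1), (-1 : ℤ) ^ k * ((2 * 2).choose k : ℤ) ^ 3 :=
  calkin 2 3 (by norm_num)

/-- The same instance by direct evaluation (`90 = 6 · 15`). [cite: Calkin1998, Theorem 1 (instance n = 2, a = 3)] -/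
example : ∑ k ∈ range (2 * 2 + 1), (-1 : ℤ) ^ k * ((2 * 2).choose k : ℤ) ^ 3 = 6 * 15 := by
  decide

/-! ## Appendix (zi-lit g18, second pass): the Remark's case `m = 1` and Corollary 4.3 at `q = 1` -/

/-- **The case `m = 1`** of the Remark after [GuoJouhetZeng2007, Theorem 4.1] ("for `m = 1` … the
left-hand side of (4.1) is equal to `0`"): for `n₁ ≥ 1`, `Σ_{k=−n₁}^{n₁} (−1)^k C(2n₁, n₁+k) = 0`
(the cyclic product of the one-term list is the single factor `C(n₁+n₁, n₁+k)`).
[cite: GuoJouhetZeng2007, Remark after Theorem 4.1 (case m = 1)] -/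
theorem altSum_singleton {n₁ : ℕ} (hn : 1 ≤ n₁) : altSum [n₁] = 0 := by
  unfold altSum cycProd
  simp only [List.headD_cons, pathProd, lastD, one_mul]
  rw [sum_Icc_neg_eq_sum_range]
  have hterm : ∀ i ∈ range (2 * n₁ + 1),
      (-1 : ℚ) ^ ((i : ℤ) - n₁) * zb (n₁ + n₁) (n₁ + ((i : ℤ) - n₁)) =
        (-1) ^ n₁ * ((-1 : ℚ) ^ i * ((2 * n₁).choose i : ℚ)) := by
    intro i _
    rw [neg_one_zpow_sub, show (n₁ : ℤ) + ((i : ℤ) - n₁) = (i : ℕ) by ring,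
      show ((n₁ : ℤ) + n₁) = ((2 * n₁ : ℕ) : ℤ) by push_cast; ring, zb_natCast]
    ring
  rw [Finset.sum_congr rfl hterm, ← Finset.mul_sum]
  have h := Int.alternating_sum_range_choose (n := 2 * n₁)
  rw [if_neg (by omega)] at h
  have h' : ∑ i ∈ range (2 * n₁ + 1), (-1 : ℚ) ^ i * ((2 * n₁).choose i : ℚ) = 0 := by exact_mod_cast h
  rw [h', mul_zero]

/-- The list `(m, n, m, n, …, m, n)` with `r` blocks. [cite: GuoJouhetZeng2007, Corollary 4.3 ("letting
n_{2i−1} = m and n_{2i} = n")] -/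
def mnList (m n : ℕ) : ℕ → List ℕ
  | 0 => []
  | r + 1 => m :: n :: mnList m n r

/-- `(m,n,…)` with `r+1` blocks has last entry `n`. [cite: GuoJouhetZeng2007, Corollary 4.3] -/
theorem lastD_mnList (m n r : ℕ) : lastD (mnList m n (r + 1)) = n := by
  induction r with
  | zero => simp [mnList, lastD]
  | succ r ih =>
    rw [show mnList m n (r + 1 + 1) = m :: n :: mnList m n (r + 1) from rfl, lastD_cons_cons,
      show n :: mnList m n (r + 1) = n :: m :: n :: mnList m n r from rfl, lastD_cons_cons]
    exact ih

/-- The consecutive product of `(m,n,…)` with `r+1` blocks is `C(m+n,m+k)^{r+1} C(n+m,n+k)^r`.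
[cite: GuoJouhetZeng2007, Corollary 4.3] -/
theorem pathProd_mnList (m n r : ℕ) (k : ℤ) :
    pathProd (mnList m n (r + 1)) k = zb (m + n) (m + k) ^ (r + 1) * zb (n + m) (n + k) ^ r := by
  induction r with
  | zero => simp [mnList, pathProd]
  | succ r ih =>
    rw [show mnList m n (r + 1 + 1) = m :: n :: m :: n :: mnList m n r from rfl, pathProd, pathProd,
      show m :: n :: mnList m n r = mnList m n (r + 1) from rfl, ih]
    ring

/-- **Corollary 4.3 of [GuoJouhetZeng2007] at `q = 1`** ("In particular,
`Σ_{k=−m}^{m} (−1)^k C(m+n, m+k)^r C(m+n, n+k)^r` is divisible by `C(m+n, m)`"), for all `m, n` and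
`r ≥ 1` (convention `C(n,k) = 0` for `k < 0`): the quotient is the natural number `iterSum (m,n,m,n,…)`.
Theorem 4.1 for the list `(m,n,…,m,n)` (`r` blocks). [cite: GuoJouhetZeng2007, Corollary 4.3 (case q = 1, "In particular")] -/
theorem corollary43 (m n r : ℕ) (hr : 1 ≤ r) :
    ∃ T : ℕ, ∑ k ∈ Finset.Icc (-(m : ℤ)) m,
        (-1 : ℚ) ^ k * (zb (m + n) (m + k) ^ r * zb (m + n) (n + k) ^ r) = ((m + n).choose m : ℚ) * T := by
  obtain ⟨s, rfl⟩ : ∃ s, r = s + 1 := ⟨r - 1, by omega⟩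
  refine ⟨iterSum (mnList m n (s + 1)), ?_⟩
  have h := theorem41 (mnList m n (s + 1)) (by simp [mnList])
  rw [altSum, lastD_mnList, show (mnList m n (s + 1)).headD 0 = m from rfl] at h
  rw [← h]
  refine Finset.sum_congr rfl fun k _ => ?_
  rw [cycProd, pathProd_mnList, lastD_mnList, show (mnList m n (s + 1)).headD 0 = m from rfl,
    show ((n : ℤ) + m) = m + n by ring]
  ring

/-- Corollary 4.3 at `m = n = r = 1`: `Σ_{k=−1}^{1} (−1)^k C(2,1+k)² = −1 + 4 − 1 = 2 = C(2,1)·1`.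
[cite: GuoJouhetZeng2007, Corollary 4.3 (instance)] -/
example : iterSum (mnList 1 1 1) = 1 := by
  simp [mnList, iterSum]

/-! ## Appendix 2: Calkin's divisor read through Kummer's theorem ("one prime per carry") -/

/-- **Calkin's theorem with Kummer's theorem**: for a prime `p`, `p^{c} ∣ Σ_{k=0}^{2n} (−1)^k C(2n,k)^a`
(`a ≥ 1`), where `c = #{i ≥ 1 : p^i ≤ (n mod p^i) + (n mod p^i)}` is the number of carries in the base-`p`
addition `n + n` — Kummer's theorem `v_p(C(2n,n)) = c` (Mathlib `padicValNat_choose`; invoked in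
[Calkin1998, §4, proof of Proposition 8: "By Kummer's theorem, at least one of the digits of `2n` written in
base `p` is odd"]) combined with Theorem 1.  (`b` is any bound with `log_p(2n) < b`.)
[cite: Calkin1998, Theorem 1 and §4 (Kummer's theorem, proof of Proposition 8)] -/
theorem calkin_carries (p n a b : ℕ) [hp : Fact p.Prime] (ha : 1 ≤ a) (hb : Nat.log p (2 * n) < b) :
    ((p : ℤ) ^ ((Finset.Ico 1 b).filter (fun i => p ^ i ≤ n % p ^ i + n % p ^ i)).card) ∣
      ∑ k ∈ range (2 * n + 1), (-1 : ℤ) ^ k * ((2 * n).choose k : ℤ) ^ a := by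
  have hv : padicValNat p ((2 * n).choose n) =
      ((Finset.Ico 1 b).filter (fun i => p ^ i ≤ n % p ^ i + n % p ^ i)).card := by
    rw [padicValNat_choose (show n ≤ 2 * n by omega) hb]
    simp only [show 2 * n - n = n by omega]
  have h1 : p ^ ((Finset.Ico 1 b).filter (fun i => p ^ i ≤ n % p ^ i + n % p ^ i)).card ∣ (2 * n).choose n := by
    rw [← hv]
    exact pow_padicValNat_dvd
  have h2 : ((p : ℤ) ^ ((Finset.Ico 1 b).filter (fun i => p ^ i ≤ n % p ^ i + n % p ^ i)).card) ∣
      ((2 * n).choose n : ℤ) := by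
    exact_mod_cast h1
  exact h2.trans (calkin n a ha)

/-- Instance: `n = 7`, `p = 2` (`7 + 7` has three carries in base 2, `v₂(C(14,7)) = v₂(3432) = 3`):
`8 ∣ Σ_k (−1)^k C(14,k)^a` for every `a ≥ 1`. [cite: Calkin1998, Theorem 1 (instance n = 7, p = 2)] -/
example (a : ℕ) (ha : 1 ≤ a) : (8 : ℤ) ∣ ∑ k ∈ range (2 * 7 + 1), (-1 : ℤ) ^ k * ((2 * 7).choose k : ℤ) ^ a := by
  have h := @calkin_carries 2 7 a 4 ⟨Nat.prime_two⟩ ha (by decide)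
  have hc : ((Finset.Ico 1 4).filter (fun i => 2 ^ i ≤ 7 % 2 ^ i + 7 % 2 ^ i)).card = 3 := by decide
  rw [hc] at h
  exact_mod_cast h

end

end Literature.Combinatorics.Enumerative.AlternatingBinomialProductSums
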